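import Summits.QuantumFields.YangMills.Theorems.BalabanUVNodesN22TermPolarizationLocalCauchy
import Literature.MathematicalPhysics.QuantumFieldTheory.Balaban1983to89.Node00.LocalizedSum17

/-!
# BalabanUVNodes ∕ node N22 = NE9 — THE (α)→(β′) LEG IN KERNEL CURRENCY, MODULE J29 (JUNCTION): THE WINDOWED HISTORY-LIPSCHITZ BOUND OF node00-def-W1's (1.7) LOCALIZED SUM
# `localizedSum F S emb` FROM TERM-LEVEL LAWS — locality of each (2.13) term through the probe embedding, a bounded holomorphic extension in the complexified probe field, term-level NE9
# uniform on the complexified ball, and a two-point tree sum — i.e. dag-n22-w3's windowed input `hK` of the (1.21) passage, PER approximation index `K`, from the terms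

Cell `pub-ymgap`, HUMAN RULING D-0062 (Track A), R134 ACCELERATION re-seat `pub-ymgap-dag-n22-c` (strategy s1), generation 11, file J29.  THEOREMS ONLY; imports J28
`…N22TermPolarizationLocalCauchy` (`hterm_of_local_holomorphic`, `contDiffAt_two_of_holomorphic`; through it J27 `abs_polWindow_sum_sub_le_of_twoPointSum_le`) and node00-def-W1's W1-20
`Node00/LocalizedSum17` (`localizedSum`, `ReadingMaps`) BY NAME.  `--supports` K3⁷ `SpineGivenEndpointR13SepCoPH` (stmt-QuantumFields-20544) as a helper.

WHY (plan g81 Q1 RULING (β), l.26065: «the walk (α)→(β′)→(β) = n22 lane»).  dag-n22-w3's `YMDAG.N22.AtKernels.ne9_EA_of_windowed` (p593053) carries NE9 from WINDOWED finite-volume joint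
history-Lipschitz bounds on def-B's `polWindow F K (k+1) (ℰ k hist K) ρ bV μ ν z`, UNIFORM in `K`, to the limiting kernels of W1-19's `U3OfKernels.objects F ℰ …`; W1-20 names the term family
of the W1 reading `ℰ := localizedSum F S emb` ([I] (1.7) «E^{(j)} = Σ_X E^{(j)}(X, …)»), interchangeable with the kernels of record under `Localizes17OfRecord₁₃`.  THIS FILE supplies that
windowed bound FOR `localizedSum F S emb`, per `K`, from PRINT-SHAPED laws of the terms `X ↦ Re E^{(k+1)}(X; hist; emb K k W)` read in def-B's exponential chart: (L) locality through
the probe embedding — the term reads the probe field `B` only on a set `supp X` of sites ([II] (1.34), [I] (1.7)); (C) a real-linear complexification `ι` of the probe fields and, per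
term and history, a function `G_X` holomorphic on an open `U ⊇ ball 0 r` with `Re G_X(ι B) =` the term's chart ([I] p.264 «an analytic function … uniformly bounded … together with all
derivatives»); (N) TERM-LEVEL NE9 uniformly on the complexified ball, `‖G_X(hist) − G_X(hist′)‖ ≤ M(X)` (in the application `M(X) = e^{−κ d(X)} Σ_i Λ_i|hist_i − hist′_i|` — the J-road's
N22 content at the W1 reading, [I] (1.18) + §5 p.298); (S) the two-point TREE SUM `Σ_{X ∋ z·, 0·} 16 M(X) N² r⁻² ≤ A e^{−κ′ d(z·, 0·)}` (`TreeLengthTorus` (1.26)-type; displayed).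
Conclusion: `|Π^{(K)}_{k+1}(hist; z) − Π^{(K)}_{k+1}(hist′; z)| ≤ A e^{−κ′ d(z·, 0·)}` — dag-n22-w3's `hK` at this `K` once `A e^{−κ′ d} ≤ e^{−κ|z|₁} Σ Λ_i|Δ hist_i|` is read off (the
torus distance of the window sites is `|z|₁` for `K` large).  Proof: J27's `abs_polWindow_sum_sub_le_of_twoPointSum_le` at `s := univ` with J28's `contDiffAt_two_of_holomorphic` and
`hterm_of_local_holomorphic`; `localizedSum` unfolds by `rfl` (W1-20 `localizedSum_apply`).

WHAT.  ★ `abs_polWindow_localizedSum_sub_le` (the junction, generic in the tower family `S`, the probe embedding `emb`, the chart `ρ, bV`); `abs_polWindow_localizedSum_sub_le_of_decay` (the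
same with (N) spelled as `M(X) := w(X)·D`, `D := Σ_i Λ_i|hist_i − hist′_i| ≥ 0` factored out of the tree sum: `≤ (A e^{−κ′ d})·D`).  These two are the HARD-LOCAL EDITION: law (L) is
inhabitable for readings `emb` LOCAL in the probe field (identity ∕ lattice-local charts, finite-range approximants).  The reading OF RECORD is the β-layer's minimizer `B ↦ U_{k+1}(exp iB)`
([I] p. 264), which is NOT local in `B` — print carries exponential tails instead ([I] p. 282, the sentence after (4.4): «if one of the functions B_i is localized outside the domain X, then we have the
additional exponential factor exp(−δ₀ dist(X, supp B_i))») and resums by the (5.10) polymer sum.  For that road: ★ `abs_polWindow_localizedSum_sub_le_soft` — the SOFT EDITION, NO locality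
law: per-term complexifications `ι X` carrying SITE WEIGHTS `‖ι X e_{l,t,c}‖ ≤ w X t` (the (4.35) analyticity domain: directions far from `X` are cheap), per-term holomorphic `G X ∕ G′ X` on open
`U X ⊇ ball 0 r` with the sup bound (N) on the ball ⇒ `|Π^{(K)}(hist; z) − Π^{(K)}(hist′; z)| ≤ Σ_X 16 M(X) r⁻² w_X(z·) w_X(0·)` (J28 `hterm_of_holomorphic_weighted` + J27
`abs_polScalar_sum_sub_le_twoPointSum` at `supp := univ`); the resummation of the right-hand side into `C e^{−δ₁|z|₁}·D` (`B12Decay510` ∕ `B12Decay510Torus` leaves), the eventual isometry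
of def-B's window and dag-n22-w3's `hK` are dag-n22-w2's `…N22WindowSoftTwoPoint` (bus l.26814), NOT typed here.

HONEST FRAMING — what this is NOT.  Count-neutral junction of J27 + J28 at W1-20's object; NO estimate of Bałaban's is proved here beyond J28's elementary Cauchy bound — the laws
(L)(C)(N)(S) and the weights `w X` are DISPLAYED hypotheses whose inhabitants at the datum of record are NODE A's ∕ N10's ∕ def-W1's ((L) NOT at the record — see WHAT; (C) = analyticity of the (2.13) terms in the configuration composed with
the probe embedding of (1.20); (N) = the J-road's term-level NE9 at the W1 reading, itself conditional on the located inputs of record — HOME `N22-RESIDUAL-CENSUS-g11.md`); the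
uniformity in `K` is the `K`-independence of `A, κ′` in (S), the producer's to exhibit; nothing of Bałaban's constructed; N22 NOT discharged (typed 28∕28 · discharged 5∕27 UNCHANGED);
NE9 NOT IN PRINT for d = 4; one finite four-torus programme at fixed ε — NOT infinite volume, NOT OS on ℝ⁴, NOT a mass gap, NOT Clay.  0 `sorry`, 0 `def`, standard axioms.

References (TYPES only): [I] = [Balaban1987RG1] (1.7) p. 261, (1.18) p. 263, (1.20)–(1.21) p. 264, p. 282 (site-weight tails: the sentence after (4.4)), (4.35)–(4.37) pp. 290–291, (5.10) p. 293, §5 p. 298; [II] = [Balaban1988RG2Cluster] (1.34) p. 9, (2.13)–(2.14) p. 15.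
-/

noncomputable section

namespace YMDAG.N22.WindowOfLocalTerms

open Filter Metric Set
open scoped BigOperators Topology
open Literature.MathematicalPhysics.QuantumFieldTheory.Balaban1983to89
open Literature.MathematicalPhysics.QuantumFieldTheory.Balaban1983to89.T4Continuum (T4Family)
open Literature.MathematicalPhysics.QuantumFieldTheory.Balaban1983to89.B12PolarizationTensor120 (polTensor polComp expChart)
open Literature.MathematicalPhysics.QuantumFieldTheory.Balaban1983to89.Node00 (polScalar polWindow siteOfInt)
open Literature.MathematicalPhysics.QuantumFieldTheory.Balaban1983to89.Node00.LocalizedSum17 (localizedSum ReadingMaps)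
open Literature.MathematicalPhysics.QuantumFieldTheory.Balaban1983to89.Node00.Sect2 (domSys)
open Literature.MathematicalPhysics.QuantumFieldTheory.Balaban1983to89.Node00.W1 (ClusterTower)

variable {𝔄 : Type*} [NormedRing 𝔄] [NormedAlgebra ℝ 𝔄] {V : Type*} [NormedAddCommGroup V] [NormedSpace ℝ V] {ι' : Type*} [Fintype ι']
  {𝔸 : Type*} {M : ℕ} (F : T4Family) (S : (K : ℕ) → ClusterTower (F.P K) 𝔸 M) (emb : ReadingMaps F 𝔄 𝔸) (ρ : V →L[ℝ] 𝔄) (bV : Module.Basis ι' ℝ V)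
  (k K : ℕ) (hist hist' : Fin (k + 1) → ℝ)
  {Ec : Type*} [NormedAddCommGroup Ec] [NormedSpace ℂ Ec]

/-- **★ THE WINDOWED HISTORY-LIPSCHITZ BOUND OF THE (1.7) LOCALIZED SUM FROM TERM-LEVEL LAWS (junction of J27 + J28 at W1-20).**  For node00-def-W1's term family
`localizedSum F S emb` on the torus `T^{(k+1)}` of the `K`-th approximation and two coupling histories `hist, hist′`: if every term `X` (a scale-`(k+1)` domain), read in def-B's exponential
chart, (L) reads the probe field only on the sites of `supp X`, (C) is at both histories the real part of a function `G X ∕ G′ X` holomorphic on an open `U ⊇ ball 0 r` of a complex normed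
space through the real-linear `ι`, (N) with `‖G X − G′ X‖ ≤ M X` on the ball (term-level NE9, uniform on the complexified ball), the one-site directions of the colour basis having
`‖ι e‖ ≤ N`, and (S) the two-point tree sum over the terms containing BOTH window sites is `≤ A e^{−κ′ d(z·, 0·)}`, then the windowed kernel (1.21) of the sum at separation `z` differs
between the two histories by at most `A e^{−κ′ d(z·, 0·)}` — dag-n22-w3's `hK` at this `K`. [cite: Balaban1987RG1, (1.7) p.261, (1.18) p.263, (1.20)-(1.21) p.264 and §5 p.298; Balaban1988RG2Cluster, (1.34) p.9] -/
theorem abs_polWindow_localizedSum_sub_le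
    (supp : (domSys (F.P K) M (k + 1)).Dom → Set (Site (F.P K) (k + 1))) [∀ X, DecidablePred (· ∈ supp X)]
    (hloc : ∀ (X : (domSys (F.P K) M (k + 1)).Dom) (B B' : Fin (F.P K).d → Site (F.P K) (k + 1) → V), (∀ l, ∀ t ∈ supp X, B l t = B' l t) →
      expChart (fun W => (((S K) k).E hist (emb K k W) X).re) ρ B = expChart (fun W => (((S K) k).E hist (emb K k W) X).re) ρ B')
    (hloc' : ∀ (X : (domSys (F.P K) M (k + 1)).Dom) (B B' : Fin (F.P K).d → Site (F.P K) (k + 1) → V), (∀ l, ∀ t ∈ supp X, B l t = B' l t) →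
      expChart (fun W => (((S K) k).E hist' (emb K k W) X).re) ρ B = expChart (fun W => (((S K) k).E hist' (emb K k W) X).re) ρ B')
    (ι : (Fin (F.P K).d → Site (F.P K) (k + 1) → V) →L[ℝ] Ec) (G G' : (domSys (F.P K) M (k + 1)).Dom → Ec → ℂ) {U : Set Ec} (hU : IsOpen U)
    (hG : ∀ X, DifferentiableOn ℂ (G X) U) (hG' : ∀ X, DifferentiableOn ℂ (G' X) U) {r : ℝ} (hr : 0 < r) (hrU : ball (0 : Ec) r ⊆ U)
    (hf : ∀ X B, expChart (fun W => (((S K) k).E hist (emb K k W) X).re) ρ B = (G X (ι B)).re)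
    (hf' : ∀ X B, expChart (fun W => (((S K) k).E hist' (emb K k W) X).re) ρ B = (G' X (ι B)).re)
    (Mx : (domSys (F.P K) M (k + 1)).Dom → ℝ) (hM : ∀ X, ∀ z ∈ ball (0 : Ec) r, ‖G X z - G' X z‖ ≤ Mx X)
    {N : ℝ} (hN : ∀ (l : Fin (F.P K).d) (t : Site (F.P K) (k + 1)) (c : ι'), ‖ι (Pi.single l (Pi.single t (bV c)))‖ ≤ N)
    (μ ν : Fin 4) (z : Fin 4 → ℤ) {d : Site (F.P K) (k + 1) → Site (F.P K) (k + 1) → ℝ} {A κ' : ℝ}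
    (htree : ∑ X ∈ Finset.univ.filter (fun X => siteOfInt F K (k + 1) z ∈ supp X ∧ siteOfInt F K (k + 1) 0 ∈ supp X), 16 * Mx X / r ^ 2 * N ^ 2 ≤
      A * Real.exp (-(κ' * d (siteOfInt F K (k + 1) z) (siteOfInt F K (k + 1) 0)))) :
    |polWindow F K (k + 1) (localizedSum F S emb k hist K) ρ bV μ ν z - polWindow F K (k + 1) (localizedSum F S emb k hist' K) ρ bV μ ν z| ≤
      A * Real.exp (-(κ' * d (siteOfInt F K (k + 1) z) (siteOfInt F K (k + 1) 0))) := by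
  have hι0 : ι 0 ∈ U := by rw [map_zero]; exact hrU (mem_ball_self hr)
  have hM0 : ∀ X, 0 ≤ Mx X := fun X => (norm_nonneg _).trans (hM X 0 (mem_ball_self hr))
  have h := abs_polWindow_sum_sub_le_of_twoPointSum_le F K (k + 1) Finset.univ
    (fun X W => (((S K) k).E hist (emb K k W) X).re) (fun X W => (((S K) k).E hist' (emb K k W) X).re) ρ bV
    (fun X _ => by rw [show expChart (fun W => (((S K) k).E hist (emb K k W) X).re) ρ = fun B => (G X (ι B)).re from funext (hf X)]
                   exact contDiffAt_two_of_holomorphic (G X) (hG X) hU ι hι0)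
    (fun X _ => by rw [show expChart (fun W => (((S K) k).E hist' (emb K k W) X).re) ρ = fun B => (G' X (ι B)).re from funext (hf' X)]
                   exact contDiffAt_two_of_holomorphic (G' X) (hG' X) hU ι hι0)
    supp (fun X => 16 * Mx X / r ^ 2 * N ^ 2) (fun X _ => by have := hM0 X; positivity) μ ν z
    (fun X _ c => hterm_of_local_holomorphic _ _ ρ bV (supp X) (hloc X) (hloc' X) (G X) (G' X) (hG X) (hG' X) hU hr hrU (hM X) ι (hf X) (hf' X) hN _ _ _ _ c)
    htree
  have e1 : localizedSum F S emb k hist K = fun U => ∑ X : (domSys (F.P K) M (k + 1)).Dom, (((S K) k).E hist (emb K k U) X).re := rfl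
  have e2 : localizedSum F S emb k hist' K = fun U => ∑ X : (domSys (F.P K) M (k + 1)).Dom, (((S K) k).E hist' (emb K k U) X).re := rfl
  rw [e1, e2]; exact h

/-- **The same with the NE9 modulus factored out**: if (N) reads `‖G X(hist) − G X(hist′)‖ ≤ w(X)·D` on the ball — `D := Σ_i Λ_i|hist_i − hist′_i|`, `w(X) = e^{−κ d(X)}` in the application,
`D ≥ 0` — and the decay-weighted two-point tree sum is `Σ_{X ∋ z·,0·} 16 w(X) N² r⁻² ≤ A e^{−κ′ d(z·,0·)}` (K-INDEPENDENT `A, κ′` = the uniformity dag-n22-w3's passage needs), then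
`|Π^{(K)}(hist; z) − Π^{(K)}(hist′; z)| ≤ (A e^{−κ′ d(z·,0·)})·D`. [cite: Balaban1987RG1, (1.18) p.263, (1.20)-(1.21) p.264 and §5 p.298] -/
theorem abs_polWindow_localizedSum_sub_le_of_decay
    (supp : (domSys (F.P K) M (k + 1)).Dom → Set (Site (F.P K) (k + 1))) [∀ X, DecidablePred (· ∈ supp X)]
    (hloc : ∀ (X : (domSys (F.P K) M (k + 1)).Dom) (B B' : Fin (F.P K).d → Site (F.P K) (k + 1) → V), (∀ l, ∀ t ∈ supp X, B l t = B' l t) →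
      expChart (fun W => (((S K) k).E hist (emb K k W) X).re) ρ B = expChart (fun W => (((S K) k).E hist (emb K k W) X).re) ρ B')
    (hloc' : ∀ (X : (domSys (F.P K) M (k + 1)).Dom) (B B' : Fin (F.P K).d → Site (F.P K) (k + 1) → V), (∀ l, ∀ t ∈ supp X, B l t = B' l t) →
      expChart (fun W => (((S K) k).E hist' (emb K k W) X).re) ρ B = expChart (fun W => (((S K) k).E hist' (emb K k W) X).re) ρ B')
    (ι : (Fin (F.P K).d → Site (F.P K) (k + 1) → V) →L[ℝ] Ec) (G G' : (domSys (F.P K) M (k + 1)).Dom → Ec → ℂ) {U : Set Ec} (hU : IsOpen U)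
    (hG : ∀ X, DifferentiableOn ℂ (G X) U) (hG' : ∀ X, DifferentiableOn ℂ (G' X) U) {r : ℝ} (hr : 0 < r) (hrU : ball (0 : Ec) r ⊆ U)
    (hf : ∀ X B, expChart (fun W => (((S K) k).E hist (emb K k W) X).re) ρ B = (G X (ι B)).re)
    (hf' : ∀ X B, expChart (fun W => (((S K) k).E hist' (emb K k W) X).re) ρ B = (G' X (ι B)).re)
    (wt : (domSys (F.P K) M (k + 1)).Dom → ℝ) {D : ℝ} (hD : 0 ≤ D)
    (hM : ∀ X, ∀ z ∈ ball (0 : Ec) r, ‖G X z - G' X z‖ ≤ wt X * D)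
    {N : ℝ} (hN : ∀ (l : Fin (F.P K).d) (t : Site (F.P K) (k + 1)) (c : ι'), ‖ι (Pi.single l (Pi.single t (bV c)))‖ ≤ N)
    (μ ν : Fin 4) (z : Fin 4 → ℤ) {d : Site (F.P K) (k + 1) → Site (F.P K) (k + 1) → ℝ} {A κ' : ℝ}
    (htree : ∑ X ∈ Finset.univ.filter (fun X => siteOfInt F K (k + 1) z ∈ supp X ∧ siteOfInt F K (k + 1) 0 ∈ supp X), 16 * wt X / r ^ 2 * N ^ 2 ≤
      A * Real.exp (-(κ' * d (siteOfInt F K (k + 1) z) (siteOfInt F K (k + 1) 0)))) :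
    |polWindow F K (k + 1) (localizedSum F S emb k hist K) ρ bV μ ν z - polWindow F K (k + 1) (localizedSum F S emb k hist' K) ρ bV μ ν z| ≤
      A * Real.exp (-(κ' * d (siteOfInt F K (k + 1) z) (siteOfInt F K (k + 1) 0))) * D := by
  refine abs_polWindow_localizedSum_sub_le F S emb ρ bV k K hist hist' supp hloc hloc' ι G G' hU hG hG' hr hrU hf hf' (fun X => wt X * D) hM hN μ ν z
    (d := d) (A := A * D) (κ' := κ') ?_ |>.trans (le_of_eq (by ring))
  have hsum : ∑ X ∈ Finset.univ.filter (fun X => siteOfInt F K (k + 1) z ∈ supp X ∧ siteOfInt F K (k + 1) 0 ∈ supp X), 16 * (wt X * D) / r ^ 2 * N ^ 2 =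
      (∑ X ∈ Finset.univ.filter (fun X => siteOfInt F K (k + 1) z ∈ supp X ∧ siteOfInt F K (k + 1) 0 ∈ supp X), 16 * wt X / r ^ 2 * N ^ 2) * D := by
    rw [Finset.sum_mul]; exact Finset.sum_congr rfl fun X _ => by ring
  rw [hsum]
  calc (∑ X ∈ Finset.univ.filter (fun X => siteOfInt F K (k + 1) z ∈ supp X ∧ siteOfInt F K (k + 1) 0 ∈ supp X), 16 * wt X / r ^ 2 * N ^ 2) * D
      ≤ A * Real.exp (-(κ' * d (siteOfInt F K (k + 1) z) (siteOfInt F K (k + 1) 0))) * D := mul_le_mul_of_nonneg_right htree hD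
    _ = A * D * Real.exp (-(κ' * d (siteOfInt F K (k + 1) z) (siteOfInt F K (k + 1) 0))) := by ring

/-- **★ SOFT EDITION (no locality law; the road of the reading of record).**  For node00-def-W1's term family `localizedSum F S emb` and two coupling histories: if every term `X`,
read in def-B's exponential chart, is at both histories the real part of a function `G X ∕ G′ X` holomorphic on an open `U X ⊇ ball 0 r` of a complex normed space through a PER-TERM
real-linear complexification `ι X` whose one-site colour directions have SITE-WEIGHTED norms `‖ι X e_{l,t,c}‖ ≤ w X t` ([I] p. 282, after (4.4): `w X t = e^{−δ₀ dist(t, X)}`-type), with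
the sup bound (N) `‖G X − G′ X‖ ≤ M X` on the ball, then the windowed kernel (1.21) of the sum at separation `z` differs between the two histories by at most the SOFT two-point sum
`Σ_X 16 M(X) r⁻² · w_X(z·) · w_X(0·)` over ALL terms — the summand dag-n22-w2's (5.10) polymer resummation consumes.  J28 `hterm_of_holomorphic_weighted` + J27
`abs_polScalar_sum_sub_le_twoPointSum` at `supp := univ`. [cite: Balaban1987RG1, (1.7) p.261, (1.20)-(1.21) p.264, (4.35)-(4.37) p.282 and (5.10) p.293] -/
theorem abs_polWindow_localizedSum_sub_le_soft
    (ι : (domSys (F.P K) M (k + 1)).Dom → ((Fin (F.P K).d → Site (F.P K) (k + 1) → V) →L[ℝ] Ec)) (G G' : (domSys (F.P K) M (k + 1)).Dom → Ec → ℂ)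
    (U : (domSys (F.P K) M (k + 1)).Dom → Set Ec) (hU : ∀ X, IsOpen (U X))
    (hG : ∀ X, DifferentiableOn ℂ (G X) (U X)) (hG' : ∀ X, DifferentiableOn ℂ (G' X) (U X)) {r : ℝ} (hr : 0 < r) (hrU : ∀ X, ball (0 : Ec) r ⊆ U X)
    (hf : ∀ X B, expChart (fun W => (((S K) k).E hist (emb K k W) X).re) ρ B = (G X (ι X B)).re)
    (hf' : ∀ X B, expChart (fun W => (((S K) k).E hist' (emb K k W) X).re) ρ B = (G' X (ι X B)).re)
    (Mx : (domSys (F.P K) M (k + 1)).Dom → ℝ) (hM : ∀ X, ∀ z ∈ ball (0 : Ec) r, ‖G X z - G' X z‖ ≤ Mx X)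
    (w : (domSys (F.P K) M (k + 1)).Dom → Site (F.P K) (k + 1) → ℝ)
    (hw₀ : ∀ X t, 0 ≤ w X t) (hw : ∀ X (l : Fin (F.P K).d) (t : Site (F.P K) (k + 1)) (c : ι'), ‖ι X (Pi.single l (Pi.single t (bV c)))‖ ≤ w X t)
    (μ ν : Fin 4) (z : Fin 4 → ℤ) :
    |polWindow F K (k + 1) (localizedSum F S emb k hist K) ρ bV μ ν z - polWindow F K (k + 1) (localizedSum F S emb k hist' K) ρ bV μ ν z| ≤
      ∑ X : (domSys (F.P K) M (k + 1)).Dom, 16 * Mx X / r ^ 2 * (w X (siteOfInt F K (k + 1) z) * w X (siteOfInt F K (k + 1) 0)) := by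
  classical
  have hι0 : ∀ X, ι X 0 ∈ U X := fun X => by rw [map_zero]; exact hrU X (mem_ball_self hr)
  have hM0 : ∀ X, 0 ≤ Mx X := fun X => (norm_nonneg _).trans (hM X 0 (mem_ball_self hr))
  have h := abs_polScalar_sum_sub_le_twoPointSum Finset.univ
    (fun X W => (((S K) k).E hist (emb K k W) X).re) (fun X W => (((S K) k).E hist' (emb K k W) X).re) ρ bV
    (fun X _ => by rw [show expChart (fun W => (((S K) k).E hist (emb K k W) X).re) ρ = fun B => (G X (ι X B)).re from funext (hf X)]
                   exact contDiffAt_two_of_holomorphic (G X) (hG X) (hU X) (ι X) (hι0 X))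
    (fun X _ => by rw [show expChart (fun W => (((S K) k).E hist' (emb K k W) X).re) ρ = fun B => (G' X (ι X B)).re from funext (hf' X)]
                   exact contDiffAt_two_of_holomorphic (G' X) (hG' X) (hU X) (ι X) (hι0 X))
    (fun _ => (Set.univ : Set (Site (F.P K) (k + 1))))
    (fun X => 16 * Mx X / r ^ 2 * (w X (siteOfInt F K (k + 1) z) * w X (siteOfInt F K (k + 1) 0)))
    (fun X _ => by have := hM0 X; have := hw₀ X (siteOfInt F K (k + 1) z); have := hw₀ X (siteOfInt F K (k + 1) 0); positivity)
    (Fin.cast (F.P_d K).symm μ) (siteOfInt F K (k + 1) z) (Fin.cast (F.P_d K).symm ν) (siteOfInt F K (k + 1) 0)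
    (fun X _ c => by
      rw [if_pos ⟨Set.mem_univ _, Set.mem_univ _⟩]
      exact hterm_of_holomorphic_weighted _ _ ρ bV (G X) (G' X) (hG X) (hG' X) (hU X) hr (hrU X) (hM X) (ι X) (hf X) (hf' X) (w X) (hw X) _ _ _ _ c)
  rw [Finset.filter_true_of_mem (fun X _ => ⟨Set.mem_univ _, Set.mem_univ _⟩)] at h
  have e1 : localizedSum F S emb k hist K = fun U => ∑ X : (domSys (F.P K) M (k + 1)).Dom, (((S K) k).E hist (emb K k U) X).re := rfl
  have e2 : localizedSum F S emb k hist' K = fun U => ∑ X : (domSys (F.P K) M (k + 1)).Dom, (((S K) k).E hist' (emb K k U) X).re := rfl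
  rw [e1, e2]; exact h

/-! ## v1.1 (append-only) — the VALUE edition of the soft bound (dag-n22-w2 g2's `hΔ`, bus l.27477) -/

/-- **★ SOFT EDITION, VALUE (the kernel itself; for the windowed (5.10) decay — (D4)'s input).**  For node00-def-W1's term family `localizedSum F S emb` at ONE
coupling history: if every term `X`, read in def-B's exponential chart, is the real part of a function `G X` holomorphic on an open `U X ⊇ ball 0 r` through a
per-term real-linear complexification `ι X` with SITE-WEIGHTED one-site colour directions `‖ι X e_{l,t,c}‖ ≤ w X t` (`w ≥ 0`), and `‖G X‖ ≤ M X` on the ball, then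
the windowed kernel (1.21) of the sum at separation `z` is at most the soft two-point sum `Σ_X 16·M(X)·r⁻²·w_X(z·)·w_X(0·)` — J27's VALUE twin
`abs_polScalar_sum_le_twoPointSum` at `supp := univ` with J28's `abs_polTensor_le_of_holomorphic`; the summand dag-n22-w2's `windowedDecay_localizedSum_of_softSum`
resums. [cite: Balaban1987RG1, (1.7) p.261, (1.18) p.263, (1.20)-(1.21) p.264, (4.35)-(4.37) pp.290-291 and (5.10) p.293] -/
theorem abs_polWindow_localizedSum_le_soft
    (ι : (domSys (F.P K) M (k + 1)).Dom → ((Fin (F.P K).d → Site (F.P K) (k + 1) → V) →L[ℝ] Ec)) (G : (domSys (F.P K) M (k + 1)).Dom → Ec → ℂ)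
    (U : (domSys (F.P K) M (k + 1)).Dom → Set Ec) (hU : ∀ X, IsOpen (U X))
    (hG : ∀ X, DifferentiableOn ℂ (G X) (U X)) {r : ℝ} (hr : 0 < r) (hrU : ∀ X, ball (0 : Ec) r ⊆ U X)
    (hf : ∀ X B, expChart (fun W => (((S K) k).E hist (emb K k W) X).re) ρ B = (G X (ι X B)).re)
    (Mx : (domSys (F.P K) M (k + 1)).Dom → ℝ) (hM : ∀ X, ∀ z ∈ ball (0 : Ec) r, ‖G X z‖ ≤ Mx X)
    (w : (domSys (F.P K) M (k + 1)).Dom → Site (F.P K) (k + 1) → ℝ)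
    (hw₀ : ∀ X t, 0 ≤ w X t) (hw : ∀ X (l : Fin (F.P K).d) (t : Site (F.P K) (k + 1)) (c : ι'), ‖ι X (Pi.single l (Pi.single t (bV c)))‖ ≤ w X t)
    (μ ν : Fin 4) (z : Fin 4 → ℤ) :
    |polWindow F K (k + 1) (localizedSum F S emb k hist K) ρ bV μ ν z| ≤
      ∑ X : (domSys (F.P K) M (k + 1)).Dom, 16 * Mx X / r ^ 2 * (w X (siteOfInt F K (k + 1) z) * w X (siteOfInt F K (k + 1) 0)) := by
  classical
  have hι0 : ∀ X, ι X 0 ∈ U X := fun X => by rw [map_zero]; exact hrU X (mem_ball_self hr)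
  have hM0 : ∀ X, 0 ≤ Mx X := fun X => (norm_nonneg _).trans (hM X 0 (mem_ball_self hr))
  have h := abs_polScalar_sum_le_twoPointSum Finset.univ (fun X W => (((S K) k).E hist (emb K k W) X).re) ρ bV
    (fun X _ => by rw [show expChart (fun W => (((S K) k).E hist (emb K k W) X).re) ρ = fun B => (G X (ι X B)).re from funext (hf X)]
                   exact contDiffAt_two_of_holomorphic (G X) (hG X) (hU X) (ι X) (hι0 X))
    (fun _ => (Set.univ : Set (Site (F.P K) (k + 1))))
    (fun X => 16 * Mx X / r ^ 2 * (w X (siteOfInt F K (k + 1) z) * w X (siteOfInt F K (k + 1) 0)))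
    (fun X _ => by have := hM0 X; have := hw₀ X (siteOfInt F K (k + 1) z); have := hw₀ X (siteOfInt F K (k + 1) 0); positivity)
    (Fin.cast (F.P_d K).symm μ) (siteOfInt F K (k + 1) z) (Fin.cast (F.P_d K).symm ν) (siteOfInt F K (k + 1) 0)
    (fun X _ c => by
      rw [if_pos ⟨Set.mem_univ _, Set.mem_univ _⟩]
      simp only [polComp]
      have h16 : 0 ≤ 16 * Mx X / r ^ 2 := by have := hM0 X; positivity
      calc |polTensor ℝ (expChart (fun W => (((S K) k).E hist (emb K k W) X).re) ρ) (Fin.cast (F.P_d K).symm μ) (siteOfInt F K (k + 1) z) (bV c)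
              (Fin.cast (F.P_d K).symm ν) (siteOfInt F K (k + 1) 0) (bV c)|
          ≤ 16 * Mx X / r ^ 2 * ‖ι X (Pi.single (Fin.cast (F.P_d K).symm μ) (Pi.single (siteOfInt F K (k + 1) z) (bV c)))‖ *
              ‖ι X (Pi.single (Fin.cast (F.P_d K).symm ν) (Pi.single (siteOfInt F K (k + 1) 0) (bV c)))‖ :=
            abs_polTensor_le_of_holomorphic (G X) (hG X) (hU X) hr (hrU X) (hM X) (ι X) _ (hf X) _ _ _ _ _ _
        _ ≤ 16 * Mx X / r ^ 2 * w X (siteOfInt F K (k + 1) z) * w X (siteOfInt F K (k + 1) 0) :=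
            mul_le_mul (mul_le_mul_of_nonneg_left (hw X _ _ c) h16) (hw X _ _ c) (norm_nonneg _) (mul_nonneg h16 (hw₀ X _))
        _ = 16 * Mx X / r ^ 2 * (w X (siteOfInt F K (k + 1) z) * w X (siteOfInt F K (k + 1) 0)) := by ring)
  rw [Finset.filter_true_of_mem (fun X _ => ⟨Set.mem_univ _, Set.mem_univ _⟩)] at h
  have e1 : localizedSum F S emb k hist K = fun U => ∑ X : (domSys (F.P K) M (k + 1)).Dom, (((S K) k).E hist (emb K k U) X).re := rfl
  rw [e1]; exact h

end YMDAG.N22.WindowOfLocalTerms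

end
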